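import Summits.KontsevichZagierPeriods.KontsevichZagierPeriods.Theses.HurwitzMicroSectors
import Summits.KontsevichZagierPeriods.KontsevichZagierPeriods.Theorems.HurwitzMicroSectorsNormalFormPrinciplePiBoxTransfer
import Summits.KontsevichZagierPeriods.KontsevichZagierPeriods.Theorems.HurwitzMicroSectorsNormalFormPrincipleVariants2319

/-! TTRL-lite variant V2317 of stmt-KontsevichZagierPeriods-3869

Variant V2317 = `stub_boxRigidity` (the leaf `BoxRigidity` of `NormalFormPrinciple`: two representations
on open unit boxes with integrands of KZ's rational shape `p/q` over `ℚ` and equal values are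
KZ-equivalent) under the move `fix_nat:m=6; bound_nat:m'≤8` (left dimension frozen to `6`, right
dimension bounded by `8`). Verdict of the attempt seat: **open** — this file is the exact-strength
certificate, not a proof of the variant. Writing `BoxVanishing K` for "every box-rational representation
of dimension `K` and value `0` is a relation", proved from the tree's `pad_le` / `exists_zeroRep`, soundness
`relations_le_ker_eval_holds` and the padding half `boxRigidityLe_eight_of_boxVanishing_eight` (`…Variants2319`):
* `boxVanishing_eight_of_stub_boxRigidity_var2317`: V2317 ⇒ **BoxVanishing 8** (compare the zero
  representation on the `6`-box with a vanishing box-rational representation on `(0,1)⁸`, `m' = 8 ≤ 8`);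
* `stub_boxRigidity_var2317_iff_boxVanishing_eight` / `_iff_le_eight`: V2317 ⟺ BoxVanishing 8 ⟺
  `BoxRigidity` for ALL `m, m' ≤ 8` (pad both representations to `(0,1)⁸` by Newton–Leibniz moves and
  null faces, subtract there by rule 1b); the difference vanishes by soundness) — Conjecture 1 of
  Kontsevich–Zagier for every pair of rational integrands on the boxes `(0,1)^{≤ 8}` (periods `π²…π⁸`,
  `ζ(3)`, `ζ(5)`, `ζ(7)`, `ζ(3)ζ(5)`, Catalan's `G`, every multiple zeta value of weight `≤ 8`); the frozen
  `6 ≤ 8` is idle, so V2317 coincides with the siblings of maximal dimension `8` (pairs `(6,8)`, `(8,2)`,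
  `(2,8)`, `m = 8 ∧ m' ≤ 2`, …: `stub_boxRigidity_var2317_iff_pair_six_eight`);
* `boxVanishing_le_eight_of_stub_boxRigidity_var2317`: V2317 gives `BoxVanishing j` for every `j ≤ 8`;
  already `j = 2` contains Catalan's dichotomy (`a + b·G = 0 ⇒ [a + b/(1+x²y²)]_{(0,1)²}` is a relation)
  and `j = 5` contains `ζ(5)`'s (`a + b·ζ(5) = 0 ⇒ [a + b/(1 − x₁⋯x₅)]_{(0,1)⁵}` is a relation) — decided
  today by no theorem (irrationality open; a chain of moves would force rationality by soundness); the
  tree proves `BoxVanishing ≤ 1` only (`boxRigidity_of_le_one`, Baker). This is the residual goal;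
* `stub_boxRigidity_var2317_of_boxVanishing_eight` / `_of_parent` / `_of_statement`: `BoxVanishing 8`, the
  parent leaf and `KontsevichZagierPeriods` each imply V2317, so a refutation of the variant would refute
  Conjecture 1 for the tree's calculus; the tree has no additive invariant of `KZ.relations` finer than
  `KZ.eval` (`IntegralRep` bundles `integrableOn`, representations with null domain are relations, the
  dimension is not an invariant) — the variant is neither provable nor refutable from the tree today.
Source: M. Kontsevich, D. Zagier, *Periods* (2001), §1.2 Conjecture 1 and rules 1)–3). Pure proof file,
no definitions. -/

-- `Summit.<Summit>.<Problem>` is the tree's mandated summit-side namespace (CONVENTIONS §2); for this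
-- single-conjunct summit the two coincide, so the duplicate is deliberate.
set_option linter.dupNamespace false

noncomputable section

namespace Summit.KontsevichZagierPeriods.KontsevichZagierPeriods.Theorems

open MeasureTheory Set
open Literature.NumberTheory.Transcendental Literature.NumberTheory.Transcendental.KZ
open Summit.KontsevichZagierPeriods.KontsevichZagierPeriods.Theses.HurwitzMicroSectors
open Summit.KontsevichZagierPeriods.HurwitzMicroSectors.NormalFormPrinciple.PiBox
open Summit.KontsevichZagierPeriods.HurwitzMicroSectors.NormalFormPrinciple.PiBox.stub_boxCombineAux
  (pad_le)

/-! ## V2317 ⇒ `BoxVanishing 8` (the converse padding half is the tree's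
`boxRigidityLe_eight_of_boxVanishing_eight`, file `…Variants2319`) -/

/-- **V2317 ⇒ `BoxVanishing 8`**: the zero representation on the `6`-box (box-rational, value `0`,
itself a relation by rule 1b)) is, by the variant at `m' = 8`, KZ-equivalent to any box-rational
representation on `(0,1)⁸` of value `0`, which is therefore a relation.
[cite: KontsevichZagier2001, §1.2 Conjecture 1] -/
theorem boxVanishing_eight_of_stub_boxRigidity_var2317
    (h : ∀ (m' : ℕ) (N : IntegralRep 6) (N' : IntegralRep m'), m' ≤ 8 → N.domain = {x | ∀ i, x i ∈ Set.Ioo (0:ℝ) 1} → N.IsRational → N'.domain = {x | ∀ i, x i ∈ Set.Ioo (0:ℝ) 1} → N'.IsRational → N.value = N'.value → Equivalent N N')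
    (M : IntegralRep 8) (hMd : M.domain = {x | ∀ i, x i ∈ Set.Ioo (0:ℝ) 1}) (hMr : M.IsRational)
    (hv : M.value = 0) : of M ∈ relations := by
  obtain ⟨Z, hZd, hZi⟩ := exists_zeroRep (isSemialgebraic_box 6)
  have hZ : of Z ∈ relations := of_mem_relations_of_eqOn_zero Z (by simp [hZi, EqOn])
  have hZv : Z.value = 0 := by simp [IntegralRep.value, hZi]
  have hZr : Z.IsRational := ⟨0, 1, fun x _ => by simp, fun x _ => by simp [hZi]⟩
  have hZM : of Z - of M ∈ relations := h 8 Z M le_rfl hZd hZr hMd hMr (by rw [hv, hZv])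
  have := relations.sub_mem hZ hZM
  rwa [sub_sub_cancel] at this

/-! ## The variant V2317 itself: exactly `BoxVanishing 8` -/

/-- **V2317 ⟺ `BoxVanishing 8`** (the honest residual of the variant: every box-rational representation
on `(0,1)⁸` of value `0` is a relation; the frozen `6 ≤ 8` is idle). [cite: KontsevichZagier2001, §1.2 Conjecture 1] -/
theorem stub_boxRigidity_var2317_iff_boxVanishing_eight :
    (∀ (m' : ℕ) (N : IntegralRep 6) (N' : IntegralRep m'), m' ≤ 8 → N.domain = {x | ∀ i, x i ∈ Set.Ioo (0:ℝ) 1} → N.IsRational → N'.domain = {x | ∀ i, x i ∈ Set.Ioo (0:ℝ) 1} → N'.IsRational → N.value = N'.value → Equivalent N N') ↔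
    (∀ (M : IntegralRep 8), M.domain = {x | ∀ i, x i ∈ Set.Ioo (0:ℝ) 1} → M.IsRational →
      M.value = 0 → of M ∈ relations) :=
  ⟨boxVanishing_eight_of_stub_boxRigidity_var2317,
    fun hvan m' N N' hm' => boxRigidityLe_eight_of_boxVanishing_eight hvan 6 m' N N' (by norm_num) hm'⟩

/-- **V2317 ⟺ `BoxRigidity` for all `m, m' ≤ 8`** (the honest strength of the variant: Conjecture 1 for
all pairs of rational integrands on the open unit boxes of dimension at most `8`).
[cite: KontsevichZagier2001, §1.2 Conjecture 1] -/
theorem stub_boxRigidity_var2317_iff_le_eight :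
    (∀ (m' : ℕ) (N : IntegralRep 6) (N' : IntegralRep m'), m' ≤ 8 → N.domain = {x | ∀ i, x i ∈ Set.Ioo (0:ℝ) 1} → N.IsRational → N'.domain = {x | ∀ i, x i ∈ Set.Ioo (0:ℝ) 1} → N'.IsRational → N.value = N'.value → Equivalent N N') ↔
    (∀ (m m' : ℕ) (N : IntegralRep m) (N' : IntegralRep m'), m ≤ 8 → m' ≤ 8 →
      N.domain = {x | ∀ i, x i ∈ Set.Ioo (0:ℝ) 1} → N.IsRational →
      N'.domain = {x | ∀ i, x i ∈ Set.Ioo (0:ℝ) 1} → N'.IsRational →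
      N.value = N'.value → Equivalent N N') :=
  ⟨fun h => boxRigidityLe_eight_of_boxVanishing_eight
      (boxVanishing_eight_of_stub_boxRigidity_var2317 h),
    fun h m' N N' hm' => h 6 m' N N' (by norm_num) hm'⟩

/-- **V2317 ⟺ the frozen pair `(6, 8)`** (the sibling `fix_nat:m=6; fix_nat:m'=8`, V2316): the bound
`m' ≤ 8` matters only through its top value. [cite: KontsevichZagier2001, §1.2 Conjecture 1] -/
theorem stub_boxRigidity_var2317_iff_pair_six_eight :
    (∀ (m' : ℕ) (N : IntegralRep 6) (N' : IntegralRep m'), m' ≤ 8 → N.domain = {x | ∀ i, x i ∈ Set.Ioo (0:ℝ) 1} → N.IsRational → N'.domain = {x | ∀ i, x i ∈ Set.Ioo (0:ℝ) 1} → N'.IsRational → N.value = N'.value → Equivalent N N') ↔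
    (∀ (N : IntegralRep 6) (N' : IntegralRep 8), N.domain = {x | ∀ i, x i ∈ Set.Ioo (0:ℝ) 1} →
      N.IsRational → N'.domain = {x | ∀ i, x i ∈ Set.Ioo (0:ℝ) 1} → N'.IsRational →
      N.value = N'.value → Equivalent N N') := by
  refine ⟨fun h N N' => h 8 N N' le_rfl, fun h => stub_boxRigidity_var2317_iff_boxVanishing_eight.2 ?_⟩
  -- the pair `(6, 8)` already gives `BoxVanishing 8`, by the same comparison with the zero `6`-box
  exact boxVanishing_eight_of_stub_boxRigidity_var2317 (fun m' N N' hm' hNd hNr hN'd hN'r hv => by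
    obtain ⟨R, hRd, hRr, hR⟩ := pad_le hm' N' hN'd hN'r
    have hRv : N.value = R.value := by
      have e := relations_le_ker_eval_holds hR
      simp only [AddMonoidHom.mem_ker, map_sub, eval_of] at e
      linarith
    have := relations.sub_mem (h N R hNd hNr hRd hRr hRv) hR
    simpa [Equivalent] using this)

/-! ## Consequences downward, and the variant from above -/

/-- **V2317 ⇒ `BoxVanishing` in every dimension `j ≤ 8`** (pad to `(0,1)⁸`; the value is unchanged by
soundness): in particular the square, which contains Catalan's dichotomy, and dimension `5`, which
contains `ζ(5)`'s. [cite: KontsevichZagier2001, §1.2 Conjecture 1] -/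
theorem boxVanishing_le_eight_of_stub_boxRigidity_var2317
    (h : ∀ (m' : ℕ) (N : IntegralRep 6) (N' : IntegralRep m'), m' ≤ 8 → N.domain = {x | ∀ i, x i ∈ Set.Ioo (0:ℝ) 1} → N.IsRational → N'.domain = {x | ∀ i, x i ∈ Set.Ioo (0:ℝ) 1} → N'.IsRational → N.value = N'.value → Equivalent N N')
    {j : ℕ} (hj : j ≤ 8) (N : IntegralRep j) (hNd : N.domain = {x | ∀ i, x i ∈ Set.Ioo (0:ℝ) 1})
    (hNr : N.IsRational) (hv : N.value = 0) : of N ∈ relations := by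
  obtain ⟨R, hRd, hRr, hR⟩ := pad_le hj N hNd hNr
  have hRv : R.value = 0 := by
    have e := relations_le_ker_eval_holds hR
    simp only [AddMonoidHom.mem_ker, map_sub, eval_of] at e
    linarith
  have := relations.add_mem hR (boxVanishing_eight_of_stub_boxRigidity_var2317 h R hRd hRr hRv)
  rwa [sub_add_cancel] at this

/-- **`BoxVanishing 8` alone already proves V2317** (whoever settles Conjecture 1 for vanishing
box-rational periods of dimension `8` settles V2317, and conversely).
[cite: KontsevichZagier2001, §1.2 Conjecture 1] -/
theorem stub_boxRigidity_var2317_of_boxVanishing_eight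
    (hvan : ∀ (M : IntegralRep 8), M.domain = {x | ∀ i, x i ∈ Set.Ioo (0:ℝ) 1} → M.IsRational →
      M.value = 0 → of M ∈ relations) :
    ∀ (m' : ℕ) (N : IntegralRep 6) (N' : IntegralRep m'), m' ≤ 8 → N.domain = {x | ∀ i, x i ∈ Set.Ioo (0:ℝ) 1} → N.IsRational → N'.domain = {x | ∀ i, x i ∈ Set.Ioo (0:ℝ) 1} → N'.IsRational → N.value = N'.value → Equivalent N N' :=
  stub_boxRigidity_var2317_iff_boxVanishing_eight.2 hvan

/-- **The parent leaf ⇒ V2317** (specialisation `m := 6`, the bound on `m'` dropped; the converse is not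
claimed — the parent is `BoxVanishing` in ALL dimensions). [cite: KontsevichZagier2001, §1.2 Conjecture 1] -/
theorem stub_boxRigidity_var2317_of_parent
    (h : ∀ (m m' : ℕ) (N : IntegralRep m) (N' : IntegralRep m'), N.domain = {x | ∀ i, x i ∈ Set.Ioo (0:ℝ) 1} → N.IsRational → N'.domain = {x | ∀ i, x i ∈ Set.Ioo (0:ℝ) 1} → N'.IsRational → N.value = N'.value → Equivalent N N') :
    ∀ (m' : ℕ) (N : IntegralRep 6) (N' : IntegralRep m'), m' ≤ 8 → N.domain = {x | ∀ i, x i ∈ Set.Ioo (0:ℝ) 1} → N.IsRational → N'.domain = {x | ∀ i, x i ∈ Set.Ioo (0:ℝ) 1} → N'.IsRational → N.value = N'.value → Equivalent N N' :=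
  fun m' N N' _ => h 6 m' N N'

/-- **`KontsevichZagierPeriods ⇒ V2317`**: the variant is a special case of Conjecture 1 for the tree's
calculus (`leaves_of_statement`) — so a refutation of the variant would refute the Summit.
[cite: KontsevichZagier2001, §1.2 Conjecture 1] -/
theorem stub_boxRigidity_var2317_of_statement (h : _root_.KontsevichZagierPeriods) :
    ∀ (m' : ℕ) (N : IntegralRep 6) (N' : IntegralRep m'), m' ≤ 8 → N.domain = {x | ∀ i, x i ∈ Set.Ioo (0:ℝ) 1} → N.IsRational → N'.domain = {x | ∀ i, x i ∈ Set.Ioo (0:ℝ) 1} → N'.IsRational → N.value = N'.value → Equivalent N N' :=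
  stub_boxRigidity_var2317_of_parent (leaves_of_statement h).1

end Summit.KontsevichZagierPeriods.KontsevichZagierPeriods.Theorems

end
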